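import Summits.CriticalPhenomena.PercolationContinuityZ3.Theorems.Transplant.FKConnectivityAllQAntipodalSquareCert
import HarnessLib

/-!
# Connectivity correlation inequalities for `φ_{w,q}`, every `q > 0` — file 78a: **ROOT-SLICED SQUARE CERTIFICATES**
# (the certificate of `C_∞⁺` for a cell with a root edge `e ∈ S` lives on the configurations NOT containing `e`,
# with one extra generator: the `S`-symmetrised down-move in the `N`-direction)

Support file (`--supports stmt-CriticalPhenomena-4575`), FK sub-lane `prim-bschramm-fk-2` (gen 36); builds on p205010 (kernel theorem, internal audit
signed; external expert review pending).  No definitions, no named facts, no sorries; standard axioms.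

Setting of file 77a (`…AntipodalSquareCert`): a cell `(M, C)`, a read set `S ⊆ M`, level `ℓ = apExpC M C`, `Φ(γ) = f̂(γ)ĝ(γ)` with
`f̂(γ) = f(γ∪C) − f((M∖γ)∪C)`, the `S`-flip `τγ = (S∖γ) ∪ (γ∖S)` and the doubly odd kernel `D_J(γ) = 1{ℓ(τγ) ≤ J} − 1{ℓ(γ) ≤ J}` on the
configurations `γ ⊆ M`.  Fix a ROOT EDGE `e ∈ S`.  Since `Φ∘τ = −Φ` and `τ` maps `{γ ∌ e}` onto `{γ ∋ e}`, the levelwise antipodal sum is already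
determined by the SLICE `δ ⊆ M ∖ {e}`:  `Σ_{ℓ(γ) ≤ J} Φ(γ) = −Σ_{δ ⊆ M∖e} D_J(δ) Φ(δ)` (note `τδ ∋ e` for such `δ`).  Pairing the slice kernel
`K_J = D_J|_{δ ∌ e}` against `Φ` is nonnegative as soon as `K_J` is a nonnegative combination of
* elementary squares `δ_δ + δ_{δ+a+n} − δ_{δ+a} − δ_{δ+n}` with `a ∈ S∖e`, `n ∈ M∖S` (as in 77a), and
* **symmetrised down-moves** `δ_δ + δ_{τ'δ} − δ_{δ+n} − δ_{τ'δ+n}` with `n ∈ M∖S`, where `τ'δ = ((S∖e)∖δ) ∪ (δ∖(S∖e))` flips the `S∖e`-part: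
  on `Φ = f̂ĝ` such a move evaluates to the `(e, n)`-square of 77a, because `Φ(τ'δ) = −Φ(δ+e)` (**`FK.hat_prod_sflip_erase`**).
This is **`FK.levels_le_of_rootCert`**: a ROOT-SLICED certificate (half the variables of a square certificate, one new generator) forces the levelwise
antipodal inequality `Σ_{ℓ(γ)≤J} f̂ĝ ≤ 0` for every increasing `f` reading only `S` and every increasing `g` not reading `S`.  For `S = {e}` the
slice kernel is `1{loser} − 1{winner}` on one shell of the two-terminal network `M∖e` and the symmetrised down-moves are plain down-moves in
`N`: the certificate is exactly Theorem U's loser-to-winner transport (gen 11/13); so this file is the common generalisation of 77a and of the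
`|S| = 1` mechanism.  By folding (`Φ∘τ = −Φ`) every square certificate of 77a yields a root-sliced one and conversely (squares meeting `e` become
symmetrised down-moves), so the two checkers are equivalent; the sliced form is the one in which the structural recursion over the two-terminal
series–parallel decomposition of `M ∖ e` is naturally stated (memo FROM-fk-2-g36, FK-Q2 §45: the kernel is `ν_J∘σ − ν_J` with `ν_J = 1{L + c̄ ≤ J}`
on the network `M∖e`, exact LP census 0 failures).
[cite: Grimmett2006, §1.4 eq. (1.20) (p. 15); §3.8 Thm. (3.90) (pp. 61–62)] [cite: Wagner2006, Thm. 5.8(d), §5.3]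
-/

noncomputable section

namespace Summit.CriticalPhenomena.PercolationContinuityZ3.Theorems

namespace FK

open SimpleGraph Literature.Probability.LatticeModels Literature.Probability.Percolation
open scoped Classical

variable {V : Type*}

/-! ### Set identities for the root edge -/

/-- Re-inserting the root: for `e ∈ S`, `e ∉ δ`, flipping the `S∖e`-part of `δ` and then adding `e` is the full `S`-flip of `δ`. [folklore] -/
theorem insert_sflip_erase {S δ : Finset (Sym2 V)} {e : Sym2 V} (he : e ∈ S) (heδ : e ∉ δ) :
    insert e (S.erase e \ δ ∪ δ \ S.erase e) = S \ δ ∪ δ \ S := by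
  ext x
  by_cases hx : x = e
  · subst hx
    simp [he, heδ]
  · simp only [Finset.mem_insert, hx, false_or, Finset.mem_union, Finset.mem_sdiff, Finset.mem_erase, ne_eq,
      not_false_eq_true, true_and]

/-- A configuration of `M ∖ e` is a configuration of `M` not containing `e`. [folklore] -/
theorem subset_of_subset_erase {M δ : Finset (Sym2 V)} {e : Sym2 V} (hδ : δ ⊆ M.erase e) : δ ⊆ M ∧ e ∉ δ :=
  ⟨hδ.trans (Finset.erase_subset e M), fun h => Finset.notMem_erase e M (hδ h)⟩

/-! ### The erase-flip identity `Φ(τ'δ) = −Φ(δ + e)` -/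

/-- **Erase-flip identity.**  For `e ∈ S ⊆ M`, `f` reading only `S`, `g` not reading `S` and `δ ⊆ M ∖ e`: flipping the `S∖e`-part of `δ`
changes `f̂ĝ` into MINUS its value at `δ + e`:  `Φ(((S∖e)∖δ) ∪ (δ∖(S∖e))) = −Φ(insert e δ)`. [folklore] -/
theorem hat_prod_sflip_erase (M C S : Finset (Sym2 V)) (f g : Finset (Sym2 V) → ℝ) (hS : S ⊆ M) {e : Sym2 V} (he : e ∈ S)
    (hf : ∀ a : Sym2 V, a ∉ S → ∀ A : Finset (Sym2 V), f (insert a A) = f A)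
    (hg : ∀ a ∈ S, ∀ A : Finset (Sym2 V), g (insert a A) = g A)
    {δ : Finset (Sym2 V)} (hδ : δ ⊆ M.erase e) :
    (f (S.erase e \ δ ∪ δ \ S.erase e ∪ C) - f (M \ (S.erase e \ δ ∪ δ \ S.erase e) ∪ C)) *
        (g (S.erase e \ δ ∪ δ \ S.erase e ∪ C) - g (M \ (S.erase e \ δ ∪ δ \ S.erase e) ∪ C)) =
      -((f (insert e δ ∪ C) - f (M \ insert e δ ∪ C)) * (g (insert e δ ∪ C) - g (M \ insert e δ ∪ C))) := by
  obtain ⟨hδM, heδ⟩ := subset_of_subset_erase hδ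
  have h1 : ∀ x, x ∈ S → x ∈ M := fun x h => hS h
  have h2 : ∀ x, x ∈ δ → x ∈ M := fun x h => hδM h
  have h3 : ∀ x, x ∈ δ → x ≠ e := fun x h hx => heδ (hx ▸ h)
  have f1 : f (S.erase e \ δ ∪ δ \ S.erase e ∪ C) = f (M \ insert e δ ∪ C) := by
    refine eq_of_readOnly_inter_eq hf ?_
    ext x
    have := h1 x; have := h2 x; have := h3 x
    by_cases hx : x = e
    · subst hx; simp [he, heδ, hS he]
    · simp only [Finset.mem_inter, Finset.mem_union, Finset.mem_sdiff, Finset.mem_erase, Finset.mem_insert, hx, ne_eq,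
        not_false_eq_true, true_and, false_or]
      tauto
  have f2 : f (M \ (S.erase e \ δ ∪ δ \ S.erase e) ∪ C) = f (insert e δ ∪ C) := by
    refine eq_of_readOnly_inter_eq hf ?_
    ext x
    have := h1 x; have := h2 x; have := h3 x
    by_cases hx : x = e
    · subst hx; simp [he, heδ, hS he]
    · simp only [Finset.mem_inter, Finset.mem_union, Finset.mem_sdiff, Finset.mem_erase, Finset.mem_insert, hx, ne_eq,
        not_false_eq_true, true_and, false_or]
      tauto
  have g1 : g (S.erase e \ δ ∪ δ \ S.erase e ∪ C) = g (insert e δ ∪ C) := by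
    refine eq_of_notRead_sdiff_eq hg ?_
    ext x
    have := h1 x; have := h2 x; have := h3 x
    by_cases hx : x = e
    · subst hx; simp [he, heδ]
    · simp only [Finset.mem_sdiff, Finset.mem_union, Finset.mem_erase, Finset.mem_insert, hx, ne_eq, not_false_eq_true,
        true_and, false_or]
      tauto
  have g2 : g (M \ (S.erase e \ δ ∪ δ \ S.erase e) ∪ C) = g (M \ insert e δ ∪ C) := by
    refine eq_of_notRead_sdiff_eq hg ?_
    ext x
    have := h1 x; have := h2 x; have := h3 x
    by_cases hx : x = e
    · subst hx; simp [he, heδ]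
    · simp only [Finset.mem_sdiff, Finset.mem_union, Finset.mem_erase, Finset.mem_insert, hx, ne_eq, not_false_eq_true,
        true_and, false_or]
      tauto
  rw [f1, f2, g1, g2]
  ring

/-! ### The root-sliced certificate closes `C_∞⁺` -/

/-- **Root-sliced square certificates close `C_∞⁺`.**  Let `e ∈ S ⊆ M` be a root edge.  Suppose the slice of the doubly odd kernel,
`K_J(δ) = 1{ℓ((S∖δ)∪(δ∖S)) ≤ J} − 1{ℓ(δ) ≤ J}` on the configurations `δ ⊆ M ∖ e` (`ℓ = apExpC M C`), is a nonnegative combination of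
elementary squares `δ_δ + δ_{δ+a+n} − δ_{δ+a} − δ_{δ+n}` (`a ∈ S∖e`, `n ∈ M∖S`, weights `c ≥ 0`) and of symmetrised down-moves
`δ_δ + δ_{τ'δ} − δ_{δ+n} − δ_{τ'δ+n}` (`n ∈ M∖S`, `τ'δ = ((S∖e)∖δ)∪(δ∖(S∖e))`, weights `d ≥ 0`) — hypothesis `hcert`, in functional form.  Then
the levelwise antipodal inequality holds at level `J` for every increasing `f` reading only `S` and every increasing `g` not reading `S`.
[cite: Grimmett2006, §3.8 Thm. (3.90) (pp. 61–62); §3.9 (pp. 63–64)] [cite: Wagner2006, Thm. 5.8(d), §5.3] -/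
theorem levels_le_of_rootCert (M C S : Finset (Sym2 V)) (hS : S ⊆ M) {e : Sym2 V} (he : e ∈ S) (J : ℕ)
    (c : Finset (Sym2 V) → Sym2 V → Sym2 V → ℝ) (hc : ∀ δ a n, 0 ≤ c δ a n)
    (d : Finset (Sym2 V) → Sym2 V → ℝ) (hd : ∀ δ n, 0 ≤ d δ n)
    (hcert : ∀ Φ : Finset (Sym2 V) → ℝ,
      ∑ δ ∈ (M.erase e).powerset,
          ((if apExpC M C (S \ δ ∪ δ \ S) ≤ J then Φ δ else 0) - (if apExpC M C δ ≤ J then Φ δ else 0)) =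
        ∑ δ ∈ (M.erase e).powerset,
          (∑ a ∈ S.erase e, ∑ n ∈ M \ S, c δ a n * (Φ δ + Φ (insert a (insert n δ)) - Φ (insert a δ) - Φ (insert n δ)) +
            ∑ n ∈ M \ S, d δ n * (Φ δ + Φ (S.erase e \ δ ∪ δ \ S.erase e) - Φ (insert n δ) -
              Φ (insert n (S.erase e \ δ ∪ δ \ S.erase e)))))
    (f g : Finset (Sym2 V) → ℝ)
    (hf : ∀ a : Sym2 V, a ∉ S → ∀ A : Finset (Sym2 V), f (insert a A) = f A)
    (hg : ∀ a ∈ S, ∀ A : Finset (Sym2 V), g (insert a A) = g A)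
    (hfm : ∀ ⦃A B : Finset (Sym2 V)⦄, A ⊆ B → f A ≤ f B) (hgm : ∀ ⦃A B : Finset (Sym2 V)⦄, A ⊆ B → g A ≤ g B) :
    ∑ γ ∈ M.powerset with apExpC M C γ ≤ J, (f (γ ∪ C) - f (M \ γ ∪ C)) * (g (γ ∪ C) - g (M \ γ ∪ C)) ≤ 0 := by
  set Φ : Finset (Sym2 V) → ℝ := fun γ => (f (γ ∪ C) - f (M \ γ ∪ C)) * (g (γ ∪ C) - g (M \ γ ∪ C)) with hΦ
  have heM : e ∈ M := hS he
  have heM' : e ∉ M.erase e := Finset.notMem_erase e M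
  have hS' : S.erase e ⊆ M.erase e := Finset.erase_subset_erase e hS
  -- (1) on `Φ = f̂ĝ` a symmetrised down-move evaluates to the `(e, n)`-square
  have hsym : ∀ δ ∈ (M.erase e).powerset, ∀ n ∈ M \ S,
      Φ δ + Φ (S.erase e \ δ ∪ δ \ S.erase e) - Φ (insert n δ) - Φ (insert n (S.erase e \ δ ∪ δ \ S.erase e)) =
        Φ δ + Φ (insert e (insert n δ)) - Φ (insert e δ) - Φ (insert n δ) := by
    intro δ hδ n hn
    have hδ' : δ ⊆ M.erase e := Finset.mem_powerset.1 hδ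
    have hnS : n ∉ S := (Finset.mem_sdiff.1 hn).2
    have hne : n ≠ e := fun h => hnS (h ▸ he)
    have hnδ' : insert n δ ⊆ M.erase e :=
      Finset.insert_subset (Finset.mem_erase.2 ⟨hne, (Finset.mem_sdiff.1 hn).1⟩) hδ'
    have hnS' : n ∉ S.erase e := fun h => hnS (Finset.mem_of_mem_erase h)
    have eq1 : Φ (S.erase e \ δ ∪ δ \ S.erase e) = -Φ (insert e δ) := by
      simp only [hΦ]; exact hat_prod_sflip_erase M C S f g hS he hf hg hδ'
    have eflip : insert n (S.erase e \ δ ∪ δ \ S.erase e) = S.erase e \ insert n δ ∪ insert n δ \ S.erase e := by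
      ext x
      by_cases hx : x = n
      · subst hx; simp [hnS']
      · simp only [Finset.mem_insert, hx, false_or, Finset.mem_union, Finset.mem_sdiff]
    have eq2 : Φ (insert n (S.erase e \ δ ∪ δ \ S.erase e)) = -Φ (insert e (insert n δ)) := by
      rw [eflip]; simp only [hΦ]; exact hat_prod_sflip_erase M C S f g hS he hf hg hnδ'
    rw [eq1, eq2]
    ring
  -- (2) the right-hand side of the certificate, evaluated at `Φ`, is nonnegative
  have hR : 0 ≤ ∑ δ ∈ (M.erase e).powerset,
      (∑ a ∈ S.erase e, ∑ n ∈ M \ S, c δ a n * (Φ δ + Φ (insert a (insert n δ)) - Φ (insert a δ) - Φ (insert n δ)) +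
        ∑ n ∈ M \ S, d δ n * (Φ δ + Φ (S.erase e \ δ ∪ δ \ S.erase e) - Φ (insert n δ) -
          Φ (insert n (S.erase e \ δ ∪ δ \ S.erase e)))) := by
    refine Finset.sum_nonneg fun δ hδ => add_nonneg
      (Finset.sum_nonneg fun a ha => Finset.sum_nonneg fun n hn => ?_) (Finset.sum_nonneg fun n hn => ?_)
    · refine mul_nonneg (hc δ a n) ?_
      have := square_hat_nonneg M C S f g (Finset.mem_of_mem_erase ha) (Finset.mem_sdiff.1 hn).2 hf hg hfm hgm δ
      simpa only [hΦ] using this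
    · refine mul_nonneg (hd δ n) ?_
      rw [hsym δ hδ n hn]
      have := square_hat_nonneg M C S f g he (Finset.mem_sdiff.1 hn).2 hf hg hfm hgm δ
      simpa only [hΦ] using this
  -- (3) split the levelwise sum along `e ∈ γ` / `e ∉ γ` and fold the second half back with the `S`-flip
  have hpow : M.powerset = (insert e (M.erase e)).powerset := by rw [Finset.insert_erase heM]
  have hsplit : ∑ γ ∈ M.powerset, (if apExpC M C γ ≤ J then Φ γ else 0) =
      ∑ δ ∈ (M.erase e).powerset, (if apExpC M C δ ≤ J then Φ δ else 0) +
        ∑ δ ∈ (M.erase e).powerset, (if apExpC M C (insert e δ) ≤ J then Φ (insert e δ) else 0) := by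
    rw [hpow, Finset.sum_powerset_insert heM']
  have hflip : ∑ δ ∈ (M.erase e).powerset, (if apExpC M C (insert e δ) ≤ J then Φ (insert e δ) else 0) =
      -∑ δ ∈ (M.erase e).powerset, (if apExpC M C (S \ δ ∪ δ \ S) ≤ J then Φ δ else 0) := by
    rw [← Finset.sum_neg_distrib]
    symm
    refine Finset.sum_nbij' (fun δ => S.erase e \ δ ∪ δ \ S.erase e) (fun δ => S.erase e \ δ ∪ δ \ S.erase e)
      (fun δ hδ => ?_) (fun δ hδ => ?_) (fun δ hδ => ?_) (fun δ hδ => ?_) (fun δ hδ => ?_)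
    · exact Finset.mem_powerset.2 (sflip_subset hS' (Finset.mem_powerset.1 hδ))
    · exact Finset.mem_powerset.2 (sflip_subset hS' (Finset.mem_powerset.1 hδ))
    · exact sflip_sflip hS' (Finset.mem_powerset.1 hδ)
    · exact sflip_sflip hS' (Finset.mem_powerset.1 hδ)
    · have hδ' : δ ⊆ M.erase e := Finset.mem_powerset.1 hδ
      obtain ⟨hδM, heδ⟩ := subset_of_subset_erase hδ'
      rw [insert_sflip_erase he heδ]
      have hval : Φ (S \ δ ∪ δ \ S) = -Φ δ := by
        simp only [hΦ]
        rw [hat_sflip_of_readOnly (C := C) hS hδM hf, hat_sflip_of_notRead (C := C) hS hδM hg]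
        ring
      split_ifs <;> simp [hval]
  rw [Finset.sum_filter, hsplit, hflip]
  have key := hcert Φ
  rw [Finset.sum_sub_distrib] at key
  linarith [hR]

end FK

end Summit.CriticalPhenomena.PercolationContinuityZ3.Theorems

end
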